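import Mathlib
import HarnessLib
import Summits.NavierStokesRegularity.NavierStokesRegularity.Theorems.PoloidalWindowDoorPoloidalWindowRigidityTimeShearVariance
import Summits.NavierStokesRegularity.NavierStokesRegularity.Theorems.PoloidalWindowDoorPoloidalWindowRigiditySeparatedShearDecay

/-!
# Route `PoloidalWindowDoor`, crux `PoloidalWindowRigidity` (K2, stmt-NavierStokesRegularity-19708) — the stratum (TV)
# «time-dependent proportional shear»: Grönwall with the weight `(1 − μ)²` — the horizontal variance has no past
# (BOUNDED-SLOPE half of `stub_tv`)

Cell ns-regularity-ideate, seat ns-poloidal-K2-p3 gen 4 (stub-worker under the K2 lead; file landed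
`--supports stmt-NavierStokesRegularity-19708` as a helper).  Second brick of the global exclusion of (TV) (refuter1 K-a″,
`stub_tv` of `…K2OfLrcSpatial`).  Continuing `…TimeShearVariance` (`Ψ' ≤ (3M₀/L + 2κ)Ψ + πL·K/R`, `κ = μ′/(1−μ)`):
the source `2κΨ` is absorbed EXACTLY by the weight `(1 − μ(t))²` (`d/dt (1−μ)² = −2(1−μ)μ′ = −(1−μ)²·2κ`), i.e. by
passing from the variance of `v₂` to the variance of the Clebsch stream function `ψ = (1−μ)v₂`:

* `psi_le_TV` — Grönwall on `[t₀, t₁]` for `(1−μ)²Ψ` by the antitone comparison function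
  `e^{−A}((1−μ)²Ψ + b₀(t₁ − t))`: `(1−μ(t₁))²Ψ(t₁) ≤ e^{A(t₁)}((1−μ(t₀))²Ψ(t₀) + B²·πL K(t₁)(t₁−t₀)/R)` whenever
  `1 − μ ≤ B` on `[t₀, t₁]`;
* `variance_small_TV` — **THE HORIZONTAL VARIANCE HAS NO PAST ON (TV) WITH BOUNDED SLOPE**: if `1 − μ(τ) ≤ B` for all
  `τ ≤ t₁` (`μ < 0`), then for every height window `[a,b]` and `ε > 0` there is `R₀` with `∫_{[a,b]} V_R(t₁,z) dz ≤ ε`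
  for `R ≥ R₀` (K2-p2's `variance_small_sep` with all constants multiplied by `B²`; Type I pays as before).

The UNBOUNDED-slope branch (`1 − μ(τ) → ∞` as `τ → −∞` faster than `(−τ)^{3/8}`) is NOT reached here (TV-RESIDUAL.md §3).

WHAT THIS IS NOT: not a claim about Navier–Stokes regularity and not (TV) — one brick of a located stratum's exclusion
(bears_on LADDER-NS N0 via crux K2 = stmt-19708).
-/

noncomputable section

-- the summit and its single sub-problem share the name (CONVENTIONS §1), as in every Theorems file
set_option linter.dupNamespace false

namespace Summit.NavierStokesRegularity.NavierStokesRegularity.Theorems.PoloidalWindowDoorPoloidalWindowRigidityTimeShearDecay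

open MeasureTheory Set Function Filter Topology Metric InnerProductSpace
open scoped RealInnerProductSpace InnerProductSpace Laplacian ContDiff
open Literature.Analysis Literature.Analysis.FluidPDE
open Summit.NavierStokesRegularity.NavierStokesRegularity.Theorems.PoloidalWindowDoorPoloidalWindowRigidityWindow
open Summit.NavierStokesRegularity.NavierStokesRegularity.Theorems.PoloidalWindowDoorPoloidalWindowRigidityHorizontalMean
open Summit.NavierStokesRegularity.NavierStokesRegularity.Theorems.PoloidalWindowDoorPoloidalWindowRigidityConstantShearMeans
open Summit.NavierStokesRegularity.NavierStokesRegularity.Theorems.PoloidalWindowDoorPoloidalWindowRigidityConstantShearVariance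
open Summit.NavierStokesRegularity.NavierStokesRegularity.Theorems.PoloidalWindowDoorPoloidalWindowRigidityConstantShearGronwall
open Summit.NavierStokesRegularity.NavierStokesRegularity.Theorems.PoloidalWindowDoorPoloidalWindowRigidityConstantShearDecay
open Summit.NavierStokesRegularity.NavierStokesRegularity.Theorems.PoloidalWindowDoorPoloidalWindowRigiditySeparatedShearVariance
open Summit.NavierStokesRegularity.NavierStokesRegularity.Theorems.PoloidalWindowDoorPoloidalWindowRigidityTimeShearVariance

variable {φ : ContDiffBump (0 : EuclideanSpace ℝ (Fin 2))} {R : ℝ}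
  {v : ℝ → EuclideanSpace ℝ (Fin 3) → EuclideanSpace ℝ (Fin 3)} {C : ℝ}

section Class

variable (hrate : HasTypeITimeDecay C v) (hcont : ContinuousOn (uncurry v) (Iio (0 : ℝ) ×ˢ univ))
  (hmild : ∀ s t : ℝ, s < t → t < 0 → ∀ x,
    v t x = UnboundedOperators.heatExtension (v s) (t - s) x - oseenDuhamel 1 s v v t x)
  (hdiv : ∀ t < 0, VectorCalculus.IsDivFree (v t))
  (hpol : ∀ s < 0, ∀ y, ⟪curl (v s) y, EuclideanSpace.single 2 1⟫_ℝ = 0)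
  {μ : ℝ → ℝ} (hμneg : ∀ s < 0, μ s < 0) (hμdiff : ∀ s < 0, DifferentiableAt ℝ μ s)
  (hslope : ∀ s < 0, ∀ y, ∀ b : Fin 3, b ≠ 2 →
    fderiv ℝ (v s) y (EuclideanSpace.single 2 1) b = μ s * fderiv ℝ (v s) y (EuclideanSpace.single b 1) 2)

include hrate hcont hmild hdiv hpol hμneg hμdiff hslope

/-- **Grönwall for `(1−μ)²Ψ` on `[t₀, t₁]`**: if `1 − μ ≤ B` on `[t₀, t₁]`, then
`(1−μ(t₁))²Ψ(t₁) ≤ exp((6C/L)(√(−t₀) − √(−t₁)))·((1−μ(t₀))²Ψ(t₀) + B²·πL K(t₁)(t₁−t₀)/R)`. -/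
theorem psi_le_TV {C₁ : ℝ} (hC₁ : ∀ t < 0, ∀ y, ‖fderiv ℝ (v t) y‖ ≤ C₁ / (-t))
    {C₄ : ℝ} (hC₄ : ∀ t < 0, ∀ y, ‖deriv (fun τ => v τ y) t‖ ≤ C₄ / ((-t) * Real.sqrt (-t)))
    (hR : 0 < R) {L : ℝ} (hL : 0 < L) {t₀ t₁ : ℝ} (h01 : t₀ ≤ t₁) (ht₁ : t₁ < 0)
    {B : ℝ} (hB : ∀ τ, t₀ ≤ τ → τ ≤ t₁ → 1 - μ τ ≤ B) :
    (1 - μ t₁) ^ 2 * psi φ R v L t₁ ≤ Real.exp (6 * C / L * (Real.sqrt (-t₀) - Real.sqrt (-t₁))) *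
      ((1 - μ t₀) ^ 2 * psi φ R v L t₀ + B ^ 2 * (R⁻¹ * (8 * (C / Real.sqrt (-t₁) * (C / Real.sqrt (-t₁)) * (C / Real.sqrt (-t₁))) +
          8 * (C / Real.sqrt (-t₁) * (C₁ / (-t₁)))) * bumpK φ * (Real.pi * L)) * (t₁ - t₀)) := by
  have hA0 : IsTypeIAncientMild C v := isTypeIAncientMild_of_class hrate hcont hmild hdiv
  have hC0 : 0 ≤ C := hA0.nonneg
  have hC₁0 : 0 ≤ C₁ := by
    have h := (norm_nonneg _).trans (hC₁ t₁ ht₁ 0)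
    rw [le_div_iff₀ (neg_pos.2 ht₁)] at h
    nlinarith [neg_pos.2 ht₁]
  have hK0 : 0 ≤ bumpK φ := bumpK_nonneg φ
  -- the source term `b(t)` and its monotonicity on `t ≤ t₁`
  set Kf : ℝ → ℝ := fun t => R⁻¹ * (8 * (C / Real.sqrt (-t) * (C / Real.sqrt (-t)) * (C / Real.sqrt (-t))) +
    8 * (C / Real.sqrt (-t) * (C₁ / (-t)))) * bumpK φ * (Real.pi * L) with hKf
  have hKmono : ∀ t ≤ t₁, Kf t ≤ Kf t₁ := by
    intro t ht
    have hnt : 0 < -t₁ := neg_pos.2 ht₁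
    have h0 : C / Real.sqrt (-t) ≤ C / Real.sqrt (-t₁) :=
      div_le_div_of_nonneg_left hC0 (Real.sqrt_pos.2 hnt) (Real.sqrt_le_sqrt (by linarith))
    have h1 : C₁ / (-t) ≤ C₁ / (-t₁) := div_le_div_of_nonneg_left hC₁0 hnt (by linarith)
    have hp0 : 0 ≤ C / Real.sqrt (-t) := div_nonneg hC0 (Real.sqrt_nonneg _)
    have hp1 : 0 ≤ C₁ / (-t) := div_nonneg hC₁0 (by linarith)
    simp only [hKf]
    gcongr
  have hKpos : ∀ t ≤ t₁, 0 ≤ Kf t := by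
    intro t ht
    have hnt : 0 < -t := by linarith
    have hp0 : 0 ≤ C / Real.sqrt (-t) := div_nonneg hC0 (Real.sqrt_nonneg _)
    have hp1 : 0 ≤ C₁ / (-t) := div_nonneg hC₁0 hnt.le
    simp only [hKf]; positivity
  have hB0 : 0 ≤ B := by
    have h := hB t₁ h01 le_rfl
    linarith [hμneg t₁ ht₁]
  set b₀ : ℝ := B ^ 2 * Kf t₁ with hb₀
  have hb0 : 0 ≤ b₀ := mul_nonneg (sq_nonneg _) (hKpos t₁ le_rfl)
  -- the comparison function `Φ(t) = e^{−A(t)} ((1 − μ t)² Ψ(t) + b₀ (t₁ − t))`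
  set A : ℝ → ℝ := fun τ => 6 * C / L * (Real.sqrt (-t₀) - Real.sqrt (-τ)) with hAdef
  set Φ : ℝ → ℝ := fun τ => Real.exp (-A τ) * ((1 - μ τ) ^ 2 * psi φ R v L τ + b₀ * (t₁ - τ)) with hΦ
  have hderiv : ∀ τ, t₀ ≤ τ → τ ≤ t₁ → ∃ d ≤ 0, HasDerivAt Φ d τ := by
    intro τ hτ₀ hτ₁
    have hτ : τ < 0 := lt_of_le_of_lt hτ₁ ht₁
    have hμ' : HasDerivAt μ (deriv μ τ) τ := (hμdiff τ hτ).hasDerivAt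
    set μ' : ℝ := deriv μ τ with hμ'def
    have hW1 : 0 < 1 - μ τ := by linarith [hμneg τ hτ]
    have hWB : 1 - μ τ ≤ B := hB τ hτ₀ hτ₁
    have hA' := hasDerivAt_expo (C := C) L t₀ hτ
    have hpsi := hasDerivAt_psi (φ := φ) (R := R) hrate hcont hmild hdiv hC₄ hL.ne' hτ
    have hle := deriv_psi_le_TV (φ := φ) hrate hcont hmild hdiv hpol hslope hτ hμ' (by linarith [hμneg τ hτ]) hC₁ hR hL
    have hE : HasDerivAt (fun σ => Real.exp (-A σ)) (Real.exp (-A τ) * -(3 * (C / Real.sqrt (-τ)) / L)) τ :=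
      hA'.neg.exp
    have hW : HasDerivAt (fun σ => (1 - μ σ) ^ 2) (2 * (1 - μ τ) * (-μ')) τ := by
      have h := ((hasDerivAt_const τ (1 : ℝ)).sub hμ').pow 2
      refine h.congr_deriv ?_
      simp
    have hprod : HasDerivAt (fun σ => (1 - μ σ) ^ 2 * psi φ R v L σ)
        (2 * (1 - μ τ) * (-μ') * psi φ R v L τ + (1 - μ τ) ^ 2 * ∫ z, sliceVt φ R v τ z * wgt L z) τ :=
      hW.mul hpsi
    have hlin : HasDerivAt (fun σ => (1 - μ σ) ^ 2 * psi φ R v L σ + b₀ * (t₁ - σ))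
        ((2 * (1 - μ τ) * (-μ') * psi φ R v L τ + (1 - μ τ) ^ 2 * ∫ z, sliceVt φ R v τ z * wgt L z) + b₀ * (0 - 1)) τ :=
      hprod.add (((hasDerivAt_const τ t₁).sub (hasDerivAt_id τ)).const_mul b₀)
    refine ⟨_, ?_, hE.mul hlin⟩
    have hpos : 0 < Real.exp (-A τ) := Real.exp_pos _
    have hA'0 : 0 ≤ 3 * (C / Real.sqrt (-τ)) / L := div_nonneg (mul_nonneg (by norm_num) (div_nonneg hC0 (Real.sqrt_nonneg _))) hL.le
    have hψ0 : 0 ≤ psi φ R v L τ := psi_nonneg hrate hcont hmild hdiv L hτ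
    have hKτ := hKmono τ hτ₁
    have hKτ0 := hKpos τ hτ₁
    have hW0 : 0 ≤ (1 - μ τ) ^ 2 := sq_nonneg _
    have hWB2 : (1 - μ τ) ^ 2 ≤ B ^ 2 := pow_le_pow_left₀ hW1.le hWB 2
    -- the weight absorbs the source `2κΨ`
    have hWκ : (1 - μ τ) ^ 2 * (2 * (μ' / (1 - μ τ)) * psi φ R v L τ) = 2 * (1 - μ τ) * μ' * psi φ R v L τ := by
      field_simp
    have hmain : 2 * (1 - μ τ) * (-μ') * psi φ R v L τ + (1 - μ τ) ^ 2 * (∫ z, sliceVt φ R v τ z * wgt L z) ≤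
        (1 - μ τ) ^ 2 * (3 * (C / Real.sqrt (-τ)) / L * psi φ R v L τ) + (1 - μ τ) ^ 2 * Kf τ := by
      have h := mul_le_mul_of_nonneg_left hle hW0
      have hle' : (1 - μ τ) ^ 2 * (∫ z, sliceVt φ R v τ z * wgt L z) ≤
          (1 - μ τ) ^ 2 * (3 * (C / Real.sqrt (-τ)) / L * psi φ R v L τ) +
            (1 - μ τ) ^ 2 * (2 * (μ' / (1 - μ τ)) * psi φ R v L τ) + (1 - μ τ) ^ 2 * Kf τ := by
        have e : (1 - μ τ) ^ 2 * (3 * (C / Real.sqrt (-τ)) / L * psi φ R v L τ + 2 * (μ' / (1 - μ τ)) * psi φ R v L τ +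
            R⁻¹ * (8 * (C / Real.sqrt (-τ) * (C / Real.sqrt (-τ)) * (C / Real.sqrt (-τ))) +
              8 * (C / Real.sqrt (-τ) * (C₁ / (-τ)))) * bumpK φ * (Real.pi * L)) =
            (1 - μ τ) ^ 2 * (3 * (C / Real.sqrt (-τ)) / L * psi φ R v L τ) +
              (1 - μ τ) ^ 2 * (2 * (μ' / (1 - μ τ)) * psi φ R v L τ) + (1 - μ τ) ^ 2 * Kf τ := by
          simp only [hKf]; ring
        linarith [h, e]
      rw [hWκ] at hle'
      linarith
    have hsrc : (1 - μ τ) ^ 2 * Kf τ ≤ b₀ := by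
      rw [hb₀]
      exact mul_le_mul hWB2 hKτ hKτ0 (sq_nonneg _)
    have hrest : Real.exp (-A τ) * -(3 * (C / Real.sqrt (-τ)) / L) * ((1 - μ τ) ^ 2 * psi φ R v L τ + b₀ * (t₁ - τ)) +
        Real.exp (-A τ) * ((2 * (1 - μ τ) * (-μ') * psi φ R v L τ + (1 - μ τ) ^ 2 * ∫ z, sliceVt φ R v τ z * wgt L z) +
          b₀ * (0 - 1)) =
      Real.exp (-A τ) * ((2 * (1 - μ τ) * (-μ') * psi φ R v L τ + (1 - μ τ) ^ 2 * ∫ z, sliceVt φ R v τ z * wgt L z)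
        - 3 * (C / Real.sqrt (-τ)) / L * ((1 - μ τ) ^ 2 * psi φ R v L τ) - b₀
        - 3 * (C / Real.sqrt (-τ)) / L * (b₀ * (t₁ - τ))) := by ring
    rw [hrest]
    refine mul_nonpos_of_nonneg_of_nonpos hpos.le ?_
    have h3 : 0 ≤ 3 * (C / Real.sqrt (-τ)) / L * (b₀ * (t₁ - τ)) := mul_nonneg hA'0 (mul_nonneg hb0 (by linarith))
    nlinarith [hmain, hsrc, h3]
  -- `Φ` is antitone on `[t₀, t₁]`
  have hanti : AntitoneOn Φ (Icc t₀ t₁) := by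
    refine antitoneOn_of_deriv_nonpos (convex_Icc t₀ t₁) ?_ ?_ ?_
    · intro τ hτ
      obtain ⟨d, -, hd⟩ := hderiv τ hτ.1 hτ.2
      exact hd.continuousAt.continuousWithinAt
    · intro τ hτ
      rw [interior_Icc] at hτ
      obtain ⟨d, -, hd⟩ := hderiv τ hτ.1.le hτ.2.le
      exact hd.differentiableAt.differentiableWithinAt
    · intro τ hτ
      rw [interior_Icc] at hτ
      obtain ⟨d, hd0, hd⟩ := hderiv τ hτ.1.le hτ.2.le
      rw [hd.deriv]; exact hd0
  have hcmp := hanti (left_mem_Icc.2 h01) (right_mem_Icc.2 h01) h01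
  -- unfold the comparison `Φ t₁ ≤ Φ t₀`
  have hA₀ : A t₀ = 0 := by simp [hAdef]
  simp only [hΦ, hA₀, neg_zero, Real.exp_zero, one_mul, sub_self, mul_zero, add_zero] at hcmp
  have hpos : 0 < Real.exp (A t₁) := Real.exp_pos _
  have hmul := mul_le_mul_of_nonneg_left hcmp hpos.le
  rw [← mul_assoc, ← Real.exp_add, add_neg_cancel, Real.exp_zero, one_mul] at hmul
  simpa only [hAdef, hKf, hb₀] using hmul

set_option maxHeartbeats 400000 in
/-- **THE HORIZONTAL VARIANCE OF `v₂` HAS NO PAST ON (TV) WITH BOUNDED SLOPE.**  For a profile of the class (rate `C`,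
gradient rate `C₁`, time-derivative rate `C₄`), poloidal, with all-slices proportional shear of negative differentiable
slope `μ(·)` such that `1 − μ(τ) ≤ B` for all `τ ≤ t₁`: for every height window `[a, b]` and every `ε > 0` there is
`R₀ > 0` such that `∫_{[a,b]} V_R(t₁, z) dz ≤ ε` for all `R ≥ R₀`. -/
theorem variance_small_TV {C₁ : ℝ} (hC₁ : ∀ t < 0, ∀ y, ‖fderiv ℝ (v t) y‖ ≤ C₁ / (-t))
    {C₄ : ℝ} (hC₄ : ∀ t < 0, ∀ y, ‖deriv (fun τ => v τ y) t‖ ≤ C₄ / ((-t) * Real.sqrt (-t)))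
    {t₁ : ℝ} (ht₁ : t₁ < 0) {B : ℝ} (hB : ∀ τ, τ ≤ t₁ → 1 - μ τ ≤ B) (a b : ℝ) {ε : ℝ} (hε : 0 < ε) :
    ∃ R₀ : ℝ, 0 < R₀ ∧ ∀ R' : ℝ, R₀ ≤ R' → ∫ z in Icc a b, sliceV φ R' v t₁ z ≤ ε := by
  have hA0 : IsTypeIAncientMild C v := isTypeIAncientMild_of_class hrate hcont hmild hdiv
  have hC0 : 0 ≤ C := hA0.nonneg
  have hnt₁ : 0 < -t₁ := neg_pos.2 ht₁
  have hC₁0 : 0 ≤ C₁ := by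
    have h := (norm_nonneg _).trans (hC₁ t₁ ht₁ 0)
    rw [le_div_iff₀ hnt₁] at h
    nlinarith
  have hK0 : 0 ≤ bumpK φ := bumpK_nonneg φ
  have hB1 : 1 ≤ B := by have h := hB t₁ le_rfl; linarith [hμneg t₁ ht₁]
  have hB0 : 0 < B := lt_of_lt_of_le one_pos hB1
  -- constants
  set A₀ : ℝ := Real.exp (6 * C) with hA₀
  have hA₀0 : 0 < A₀ := Real.exp_pos _
  set M₀ : ℝ := C / Real.sqrt (-t₁) with hM₀
  set Kc : ℝ := 8 * (M₀ * M₀ * M₀) + 8 * (M₀ * (C₁ / (-t₁))) with hKc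
  have hM₀0 : 0 ≤ M₀ := div_nonneg hC0 (Real.sqrt_nonneg _)
  have hKc0 : 0 ≤ Kc := by have : 0 ≤ C₁ / (-t₁) := div_nonneg hC₁0 hnt₁.le; positivity
  -- the scale `L` and the starting time `t₀ = −L²`
  set L : ℝ := max (max |a| |b|) (max 1 (max (Real.sqrt (-t₁)) (4 * A₀ * Real.pi * C ^ 2 * B ^ 2 / ε))) with hL
  have hL1 : 1 ≤ L := le_trans (le_max_left _ _) (le_max_right _ _)
  have hL0 : 0 < L := lt_of_lt_of_le one_pos hL1
  have hLa : |a| ≤ L := le_trans (le_max_left _ _) (le_max_left _ _)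
  have hLb : |b| ≤ L := le_trans (le_max_right _ _) (le_max_left _ _)
  have hLs : Real.sqrt (-t₁) ≤ L := le_trans (le_trans (le_max_left _ _) (le_max_right _ _)) (le_max_right _ _)
  have hLε : 4 * A₀ * Real.pi * C ^ 2 * B ^ 2 / ε ≤ L :=
    le_trans (le_trans (le_max_right _ _) (le_max_right _ _)) (le_max_right _ _)
  set t₀ : ℝ := -L ^ 2 with ht₀
  have hnt₀ : -t₀ = L ^ 2 := by rw [ht₀]; ring
  have hsq : Real.sqrt (-t₀) = L := by rw [hnt₀, Real.sqrt_sq hL0.le]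
  have h01 : t₀ ≤ t₁ := by
    have h := Real.sq_sqrt hnt₁.le
    have h2 : Real.sqrt (-t₁) ^ 2 ≤ L ^ 2 := pow_le_pow_left₀ (Real.sqrt_nonneg _) hLs 2
    rw [ht₀]; linarith
  have ht₀neg : t₀ < 0 := lt_of_le_of_lt h01 ht₁
  -- the threshold in `R`
  set D : ℝ := A₀ * (B ^ 2 * (Kc * bumpK φ * (Real.pi * L)) * L ^ 2) with hD
  have hD0 : 0 ≤ D := by positivity
  refine ⟨max 1 (4 * D / ε), lt_of_lt_of_le one_pos (le_max_left _ _), fun R' hR' => ?_⟩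
  have hR'0 : 0 < R' := lt_of_lt_of_le one_pos ((le_max_left _ _).trans hR')
  have hR'D : 4 * D / ε ≤ R' := (le_max_right _ _).trans hR'
  -- Grönwall from `t₀` to `t₁`
  have hG := psi_le_TV (φ := φ) (R := R') hrate hcont hmild hdiv hpol hμneg hμdiff hslope hC₁ hC₄ hR'0 hL0 h01 ht₁
    (B := B) (fun τ _ hτ => hB τ hτ)
  rw [hsq] at hG
  have hexp : Real.exp (6 * C / L * (L - Real.sqrt (-t₁))) ≤ A₀ := by
    rw [hA₀]
    refine Real.exp_le_exp.2 ?_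
    have h1 : 6 * C / L * (L - Real.sqrt (-t₁)) = 6 * C - 6 * C * Real.sqrt (-t₁) / L := by field_simp
    rw [h1]
    have : 0 ≤ 6 * C * Real.sqrt (-t₁) / L := by positivity
    linarith
  -- the datum: `(1 − μ t₀)² Ψ(t₀) ≤ B² πC²/L`
  have hW₀ : (1 - μ t₀) ^ 2 ≤ B ^ 2 :=
    pow_le_pow_left₀ (by linarith [hμneg t₀ ht₀neg]) (hB t₀ h01) 2
  have hψ₀ : (1 - μ t₀) ^ 2 * psi φ R' v L t₀ ≤ B ^ 2 * (Real.pi * C ^ 2 / L) := by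
    have h := psi_le_rate (φ := φ) (R := R') hrate hcont hmild hdiv hL0 ht₀neg
    rw [hnt₀] at h
    have e : C ^ 2 / L ^ 2 * (Real.pi * L) = Real.pi * C ^ 2 / L := by field_simp
    rw [e] at h
    exact mul_le_mul hW₀ h (psi_nonneg hrate hcont hmild hdiv L ht₀neg) (sq_nonneg _)
  -- the endpoint weight is at least `1`
  have hW₁ : 1 ≤ (1 - μ t₁) ^ 2 := by
    have h : 1 ≤ 1 - μ t₁ := by linarith [hμneg t₁ ht₁]
    nlinarith
  have hdt : t₁ - t₀ ≤ L ^ 2 := by rw [ht₀]; linarith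
  have hb0 : 0 ≤ B ^ 2 * (R'⁻¹ * Kc * bumpK φ * (Real.pi * L)) := by positivity
  have hψ₁ : psi φ R' v L t₁ ≤ A₀ * (B ^ 2 * (Real.pi * C ^ 2 / L)) + D / R' := by
    have h2 : R'⁻¹ * (8 * (C / Real.sqrt (-t₁) * (C / Real.sqrt (-t₁)) * (C / Real.sqrt (-t₁))) +
        8 * (C / Real.sqrt (-t₁) * (C₁ / (-t₁)))) * bumpK φ * (Real.pi * L) =
        R'⁻¹ * Kc * bumpK φ * (Real.pi * L) := by rw [hKc, hM₀]
    rw [h2] at hG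
    have h1 : (1 - μ t₀) ^ 2 * psi φ R' v L t₀ + B ^ 2 * (R'⁻¹ * Kc * bumpK φ * (Real.pi * L)) * (t₁ - t₀) ≤
        B ^ 2 * (Real.pi * C ^ 2 / L) + B ^ 2 * (R'⁻¹ * Kc * bumpK φ * (Real.pi * L)) * L ^ 2 :=
      add_le_add hψ₀ (mul_le_mul_of_nonneg_left hdt hb0)
    have h0 : 0 ≤ (1 - μ t₀) ^ 2 * psi φ R' v L t₀ + B ^ 2 * (R'⁻¹ * Kc * bumpK φ * (Real.pi * L)) * (t₁ - t₀) :=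
      add_nonneg (mul_nonneg (sq_nonneg _) (psi_nonneg hrate hcont hmild hdiv L ht₀neg)) (mul_nonneg hb0 (by linarith))
    have hψ10 : 0 ≤ psi φ R' v L t₁ := psi_nonneg hrate hcont hmild hdiv L ht₁
    calc psi φ R' v L t₁ ≤ (1 - μ t₁) ^ 2 * psi φ R' v L t₁ := le_mul_of_one_le_left hψ10 hW₁
      _ ≤ A₀ * ((1 - μ t₀) ^ 2 * psi φ R' v L t₀ + B ^ 2 * (R'⁻¹ * Kc * bumpK φ * (Real.pi * L)) * (t₁ - t₀)) :=
          hG.trans (mul_le_mul_of_nonneg_right hexp h0)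
      _ ≤ A₀ * (B ^ 2 * (Real.pi * C ^ 2 / L) + B ^ 2 * (R'⁻¹ * Kc * bumpK φ * (Real.pi * L)) * L ^ 2) :=
          mul_le_mul_of_nonneg_left h1 hA₀0.le
      _ = A₀ * (B ^ 2 * (Real.pi * C ^ 2 / L)) + D / R' := by rw [hD]; field_simp
  -- both terms are `≤ ε/4`
  have hq1 : A₀ * (B ^ 2 * (Real.pi * C ^ 2 / L)) ≤ ε / 4 := by
    have e1 : A₀ * (B ^ 2 * (Real.pi * C ^ 2 / L)) = A₀ * (B ^ 2 * (Real.pi * C ^ 2)) / L := by ring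
    rw [e1, div_le_iff₀ hL0]
    have h := mul_le_mul_of_nonneg_left hLε (by positivity : (0:ℝ) ≤ ε / 4)
    have e : ε / 4 * (4 * A₀ * Real.pi * C ^ 2 * B ^ 2 / ε) = A₀ * (B ^ 2 * (Real.pi * C ^ 2)) := by field_simp
    linarith [e]
  have hq2 : D / R' ≤ ε / 4 := by
    rw [div_le_iff₀ hR'0]
    have h := mul_le_mul_of_nonneg_left hR'D (by positivity : (0:ℝ) ≤ ε / 4)
    have e : ε / 4 * (4 * D / ε) = D := by field_simp
    linarith [e]
  have hψε : psi φ R' v L t₁ ≤ ε / 2 := by linarith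
  -- from the weighted integral to the window `[a, b]`
  obtain ⟨cV, -, -, -⟩ := continuous_slices (φ := φ) (R := R') hrate hcont hmild hdiv ht₁
  have hV0 := fun z => sliceV_nonneg (φ := φ) (R := R') hrate hcont hmild hdiv ht₁ z
  have iVw1 : Integrable fun z => sliceV φ R' v t₁ z * wgt L z := by
    refine integrable_of_abs_le_mul_wgt hL0.ne' (f := fun z => sliceV φ R' v t₁ z * wgt L z)
      (cV.mul (continuous_wgt L)) (B := C ^ 2 / (-t₁)) fun z => ?_
    rw [abs_mul, abs_of_pos (wgt_pos L z), abs_of_nonneg (hV0 z)]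
    exact mul_le_mul_of_nonneg_right (sliceV_le hrate hcont hmild hdiv ht₁ z) (wgt_pos L z).le
  have iVw : Integrable fun z => 2 * (sliceV φ R' v t₁ z * wgt L z) := iVw1.const_mul 2
  have hwin : ∀ z ∈ Icc a b, sliceV φ R' v t₁ z ≤ 2 * (sliceV φ R' v t₁ z * wgt L z) := by
    intro z hz
    have ha' := abs_le.1 hLa
    have hb' := abs_le.1 hLb
    have hzL : |z| ≤ L := abs_le.2 ⟨by linarith [ha'.1, hz.1], by linarith [hb'.2, hz.2]⟩
    have hw := half_le_wgt hL0 hzL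
    have h1 : sliceV φ R' v t₁ z * (1 / 2) ≤ sliceV φ R' v t₁ z * wgt L z := mul_le_mul_of_nonneg_left hw (hV0 z)
    linarith
  calc ∫ z in Icc a b, sliceV φ R' v t₁ z ≤ ∫ z in Icc a b, 2 * (sliceV φ R' v t₁ z * wgt L z) :=
        setIntegral_mono_on cV.integrableOn_Icc iVw.integrableOn measurableSet_Icc hwin
    _ ≤ ∫ z, 2 * (sliceV φ R' v t₁ z * wgt L z) :=
        setIntegral_le_integral iVw (Eventually.of_forall fun z =>
          mul_nonneg zero_le_two (mul_nonneg (hV0 z) (wgt_pos L z).le))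
    _ = 2 * psi φ R' v L t₁ := by unfold psi; exact integral_const_mul _ _
    _ ≤ ε := by linarith

end Class

end Summit.NavierStokesRegularity.NavierStokesRegularity.Theorems.PoloidalWindowDoorPoloidalWindowRigidityTimeShearDecay

end
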